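import Summits.QuantumFields.YangMills.Theorems.LuscherReductionDressedRitzLiftLeakageAllBases
import HarnessLib

/-!
# Crux `DressedRitz` (stmt-QuantumFields-20205), line «polyakovlift», stub S-LEAK `stub_liftLeakage` — support VI:
# ONE press-button from the RG debt (reference residual law + cluster constancy + in-cluster Gram control) to the registered stub text

Support module (fleet seat ym-20205-polyakovlift-s1; `--supports stmt-QuantumFields-20205`, helper, no closure claim).  Parts II–V
(`…LiftLeakageResidual ∕ Stub ∕ AllBases ∕ ReferenceWindow`) are assembled into the single theorem the lead cites once the analytic input exists:

★★★ `liftLeakage_of_referenceLaw`: IF for every `k` there are `C ≥ 0`, `lam0 > 0` such that eventually in the femto window, at the Perron–Frobenius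
vacuum package `(Ω, θ)` (`VacDict.IsVacuum`, `Ω ≥ c > 0`), the prover EXHIBITS reference data at the lift coupling `B₁ = liftCoupling β L` — a positive
raw one-site vacuum `Ω₁`, an exact physical `l2`-orthonormal one-site eigenfamily `ψ_0 … ψ_{N−1}` (levels `λ_n`) dominating at some `0 ≤ Λ < μ_k(B₁)`
(the tree offers such data with a WINDOW-UNIFORM `N`: `LiftLeak.exists_reference_uniform`) — together with a cluster-constant approximate eigenvalue
`a : ℝ → ℝ` and rates `ρ, γ ≥ 0`, `2Nρ ≤ C(λ³/L²)λ₀²`, `Nγ ≤ 1/2`, satisfying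
  (RL) `‖K_β v_n − a(λ_n)·v_n‖² ≤ ρ‖v_n‖²` and (GR) `|⟨v_n,v_m⟩| ≤ γ‖v_n‖‖v_m‖` (`n ≠ m`, `λ_n = λ_m`) for the reference lifts `v_n = liftVec β Ω (ψ_n/Ω₁)`,
THEN the registered stub text `Stmt.stub_liftLeakage` holds (character for character, as the conclusion): the lead closes S-LEAK by
`theorem stub_liftLeakage : Stmt.stub_liftLeakage := LiftLeak.liftLeakage_of_referenceLaw h`.

Chain: `residualLaw_allBases_of_reference` (Part IV: every lift basis inherits the residual law, constant `2Nρ`) → `leakageClause_of_residual`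
(Part II: (o4) from a residual bound) → `PolyakovLift.leakageClause_iff` (raw vacua are `±Ω`, ym-infvol-p2).  (RL) and (GR) are the OPEN
renormalisation-group ∕ Born–Oppenheimer estimates (slow leakage weights `O(λ)` at levers `(λ/L)²`, stiff squared residual `O(λ³/L²)`, same-shell fine
clusters of width `O(λ²/L)λ₀`); nothing of them is proved here.

HONEST FRAMING: fixed-lattice bookkeeping on the conditional femto rung R2b1; the stub stays OPEN; nothing here bears on infinite volume, the continuum
limit or the Clay gap.  References: M. Lüscher, NPB 219 (1983) 233 [cite: Luscher1983, §3]; T. Kato, J. Phys. Soc. Japan 4 (1949) 334 [cite: Kato1949, §1];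
Reed–Simon IV Thm XIII.1, XIII.43 [cite: ReedSimonIV1978].
-/

set_option autoImplicit false

noncomputable section

open MeasureTheory Filter Topology Real Finset
open Literature.MathematicalPhysics.QuantumFieldTheory (GaugeConfig Site gaugeTransform)
open scoped BigOperators

namespace Summit.QuantumFields.YangMills.Theorems.FemtoTransferGap.LiftLeak

open Summit.QuantumFields.YangMills.Theorems.FemtoTransferGap
open Summit.QuantumFields.YangMills.Theorems.FemtoTransferGap.PolyakovLift
open Summit.QuantumFields.YangMills.Theorems.FemtoTransferGap.VacDict

/-- ★★★ **S-LEAK from the RG debt on ONE reference family per lattice point** (see the module docstring for the reading; conclusion = the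
registered stub text `Stmt.stub_liftLeakage` character for character). [cite: Luscher1983, §3] [cite: Kato1949, §1] [cite: ReedSimonIV1978, Thm XIII.1] -/
theorem liftLeakage_of_referenceLaw
    (h : ∀ k : ℕ, ∃ C lam0 : ℝ, 0 ≤ C ∧ 0 < lam0 ∧ ∀ lam : ℝ, 0 < lam → lam ≤ lam0 → ∃ L0 : ℕ,
      ∀ (L : ℕ) [NeZero L], L0 ≤ L → ∀ β : ℝ, InFemtoWindow lam β L →
        ∀ (Ω : physSubmodule L) (θ c : ℝ), IsVacuum β Ω θ → 0 < c → (∀ U, c ≤ (Ω : GaugeConfig 3 L SU2 → ℝ) U) →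
          ∃ (Ω₁ : GaugeConfig 3 1 SU2 → ℝ) (N : ℕ) (ψ : Fin N → (GaugeConfig 3 1 SU2 → ℝ)) (ev : Fin N → ℝ) (Λ : ℝ)
            (a : ℝ → ℝ) (ρ γ : ℝ),
            IsRawVacuum (liftCoupling β L) Ω₁ ∧ (∃ c₁ : ℝ, 0 < c₁ ∧ ∀ V, c₁ ≤ Ω₁ V) ∧ (∀ n, IsPhys (ψ n)) ∧
            (∀ n m, l2 (ψ n) (ψ m) = if n = m then 1 else 0) ∧ (∀ n, transferApply (liftCoupling β L) (ψ n) = ev n • ψ n) ∧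
            0 ≤ Λ ∧ Λ < levelValue su2Rep 1 (liftCoupling β L) k ∧
            (∀ χ : GaugeConfig 3 1 SU2 → ℝ, IsPhys χ → (∀ n, l2 χ (ψ n) = 0) →
              l2 χ (transferApply (liftCoupling β L) χ) ≤ Λ * l2 χ χ) ∧
            0 ≤ ρ ∧ 0 ≤ γ ∧ (N : ℝ) * γ ≤ 1 / 2 ∧
            2 * N * ρ ≤ C * (luscherLambda β L ^ 3 / (L : ℝ) ^ 2) * levelValue su2Rep L β 0 ^ 2 ∧
            (∀ n, l2 (transferApply β (liftVec β (Ω : GaugeConfig 3 L SU2 → ℝ) (ψ n / Ω₁)) -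
                    a (ev n) • liftVec β (Ω : GaugeConfig 3 L SU2 → ℝ) (ψ n / Ω₁))
                  (transferApply β (liftVec β (Ω : GaugeConfig 3 L SU2 → ℝ) (ψ n / Ω₁)) -
                    a (ev n) • liftVec β (Ω : GaugeConfig 3 L SU2 → ℝ) (ψ n / Ω₁)) ≤
                ρ * l2 (liftVec β (Ω : GaugeConfig 3 L SU2 → ℝ) (ψ n / Ω₁)) (liftVec β (Ω : GaugeConfig 3 L SU2 → ℝ) (ψ n / Ω₁))) ∧
            (∀ n m, n ≠ m → ev n = ev m →
              |l2 (liftVec β (Ω : GaugeConfig 3 L SU2 → ℝ) (ψ n / Ω₁)) (liftVec β (Ω : GaugeConfig 3 L SU2 → ℝ) (ψ m / Ω₁))| ≤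
                γ * (Real.sqrt (l2 (liftVec β (Ω : GaugeConfig 3 L SU2 → ℝ) (ψ n / Ω₁)) (liftVec β (Ω : GaugeConfig 3 L SU2 → ℝ) (ψ n / Ω₁))) *
                  Real.sqrt (l2 (liftVec β (Ω : GaugeConfig 3 L SU2 → ℝ) (ψ m / Ω₁)) (liftVec β (Ω : GaugeConfig 3 L SU2 → ℝ) (ψ m / Ω₁)))))) :
    ∀ k : ℕ, ∃ C lam0 : ℝ, 0 ≤ C ∧ 0 < lam0 ∧ ∀ lam : ℝ, 0 < lam → lam ≤ lam0 → ∃ L0 : ℕ,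
      ∀ (L : ℕ) [NeZero L], L0 ≤ L → ∀ β : ℝ, InFemtoWindow lam β L →
        ∀ φ : GaugeConfig 3 L SU2 → ℝ, IsRawVacuum β φ →
          ∀ (ω : GaugeConfig 3 1 SU2 → ℝ) (g : Fin k → (GaugeConfig 3 1 SU2 → ℝ)), LiftBasis (liftCoupling β L) k ω g →
            LeakageClause k C β (liftFamily β φ g) := by
  intro k
  obtain ⟨C, lam0, hC, hlam0, hk⟩ := h k
  refine ⟨C, lam0, hC, hlam0, fun lam hlam hle => ?_⟩
  obtain ⟨L0, hL⟩ := hk lam hlam hle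
  refine ⟨L0, fun L _ hL0 β hW φ hφ ω g hb => ?_⟩
  obtain ⟨Ω, θ, c, hV, hc, hcle⟩ := exists_isVacuum (L := L) β
  obtain ⟨Ω₁, N, ψ, ev, Λ, a, ρ, γ, hΩ₁, hpos, hψ, hon, heig, hΛ, hΛk, hdom, hρ, hγ, hNγ, hNρ, hres, hgram⟩ :=
    hL L hL0 β hW Ω θ c hV hc hcle
  have hB : 0 < liftCoupling β L := by
    unfold liftCoupling
    exact div_pos two_pos (pow_pos (luscherLambda_pos_of_window hlam hW) 3)
  have hΩphys : IsPhys (Ω : GaugeConfig 3 L SU2 → ℝ) := hV.raw.1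
  -- residual law for EVERY lift basis at the PF vacuum (Part IV), then (o4) (Part II), then transfer to `φ = ±Ω`
  have hres_all : ∀ i : Fin k, ∃ a' : ℝ,
      l2 (transferApply β (liftFamily β (Ω : GaugeConfig 3 L SU2 → ℝ) g i) - a' • liftFamily β (Ω : GaugeConfig 3 L SU2 → ℝ) g i)
          (transferApply β (liftFamily β (Ω : GaugeConfig 3 L SU2 → ℝ) g i) - a' • liftFamily β (Ω : GaugeConfig 3 L SU2 → ℝ) g i) ≤
        C * (luscherLambda β L ^ 3 / (L : ℝ) ^ 2) * levelValue su2Rep L β 0 ^ 2 *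
          l2 (liftFamily β (Ω : GaugeConfig 3 L SU2 → ℝ) g i) (liftFamily β (Ω : GaugeConfig 3 L SU2 → ℝ) g i) := by
    intro i
    obtain ⟨a', ha'⟩ := residualLaw_allBases_of_reference β hΩphys hB k hΩ₁ hpos hψ hon ev heig hΛ hΛk hdom a hρ hγ hNγ hres hgram hb i
    exact ⟨a', ha'.trans (mul_le_mul_of_nonneg_right hNρ (l2_self_nonneg _))⟩
  have hΩclause : LeakageClause k C β (liftFamily β (Ω : GaugeConfig 3 L SU2 → ℝ) g) :=
    leakageClause_of_residual C β (fun i => isPhys_liftVec β hΩphys (hb.2.2.2.2.1 i)) hres_all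
  exact (leakageClause_iff hV hφ C (fun i => flowLiftAt (L := L) 0 (flowTime β L) (g i))).2 hΩclause

end Summit.QuantumFields.YangMills.Theorems.FemtoTransferGap.LiftLeak

end
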